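import Literature.MathematicalPhysics.QuantumFieldTheory.Balaban1983to89.B9B8KnitBondTransfer

/-!
# `Balaban1983to89.B9B8KnitLandauTransfer` — JUNCTION B-LINE 3, FILE 2: the LANDAU GAUGE CONDITION on the two carriers — the [Balaban1985RegularSpaces]
# knit's (1.38) «R(U₀)D^{η*}_{U₀}A = 0» in MULTIPLIER form (`B8Eq138LandauZd.IsLandau138`: `Δ^η_{U₀}(D^{η*}_{U₀}A) = Q′(U₀)ᵀμ`) IMPLIES def-Y's
# PROJECTION form `R(U) (D*_U a) = 0` (`Node00.RY … (divY …) = 0`, [Balaban1985BackgroundPropagators] (3.21), (3.25)) at the torus member, for the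
# transporters `parKnitY` and the letter `G′ = GpY parKnitY` — the hypothesis under which (3.26)'s `D R D*` term drops out of `Δ_a(U)` (r05's B-LINE 1)

statement-level skeleton of published theorems with citation tags; proofs where landed; nothing here is a claim about the
Yang–Mills mass gap

T. Bałaban, *Propagators for lattice gauge theories in a background field*, Commun. Math. Phys. **99** (1985) 389–434
[`Balaban1985BackgroundPropagators`, "[4]"]: (3.21) p. 394 (*«R = R(U) is an orthogonal projection in the Hilbert space L²(Ω₀, 𝔤) onto the subspace
ℛ = Δ^η_U N(Q′), N(Q′) = {λ : Q′λ = 0}»*), (3.24) p. 394 (`Δ′_a = Δ^η_U + Q′*aQ′`), (3.25) p. 395 (*«Rf = (I − G′Q′*(Q′G′²Q′*)⁻¹Q′G′)f, where G′ = G′(U) =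
(Δ′_a)⁻¹»*), (3.26) p. 395, (3.8) p. 392 (`D*`), (3.19) p. 393, (3.23) p. 394.  T. Bałaban, *Spaces of regular gauge field configurations on a lattice and
gauge fixing conditions*, Commun. Math. Phys. **99** (1985) 75–102 [`Balaban1985RegularSpaces`, "[B8]"]: (1.38) p. 82 (*«R(U₀)D^{η*}_{U₀}A = 0»*), (1.42)
p. 83, (1.57) p. 86, (1.29) p. 81, p. 77 (*«Ω_j = T_η»*).  PDFs held: `paper:balaban1985-cmp99-background-propagators`,
`paper:balaban1985-cmp99-regular-spaces-gauge-fixing`.  STATUS: published, refereed.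

CITATION HEADER (lean-in-tree rule).  Cell `lit-balaban`, seat `lit-balaban-t2s-1` (gen 6), sub-row G-B8-T2S (R3 `stmt-QuantumFields-19200`, helper); B-LINE 3
FILE 2 (division r05 g86 ↔ t2s-1 g6, lead RULING #8 (2)).  REUSED BY NAME: FILE 1 `B9B8KnitBondTransfer` (`liftBd`), J-A `B9B8CarrierDictionary`
(`covDeriv_liftY`, `covLap_liftY`), A1 `B9B8KnitLetterTransfer` (`siteAt`, `liftL`, `blkAt_blk`, `blk_level`, ★ `QprimeT_liftBL_at_box`), J-B
`B9B8AveragingJunction.parKnitY` and ★ `B9B8DeltaPrimeJunction.{QprimeT_eq_compT, QT_torusLam_eq, deltaPrimeAY_sub_lapS, avgTerm_parKnitY_eq}`, def-Y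
`Node00.{divY, lapS, deltaPrimeAY, GpY, QpY, QpsY, XY, XinvY, RY, GpY_mul_deltaPrimeAY}` and `OpsYNablaBridge.divY_apply_eq_sum_cdsS`, the knit's
`B8Eq138LandauZd.{IsLandau138, QT, QprimeT, covLap, covDivB}`, `B8Eq151V2Divergence.covDerivFwd_smul`, `B8Eq146AExpansion.covDeriv_smul`.

WHY THIS FILE ∕ THE ARGUMENT.  r05's B-LINE 1 (`B8Eq158AtLettersY.eq158_atLettersY`) and B-LINE 2 take the Landau condition in def-Y's projection form
`RY i parS Gp U (divY i U a) = 0`; the (B)-line's datum (`B9P3PerAt` ∕ `B9P3ThreeAt`) carries it in the knit's multiplier form `IsLandau138W`: there is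
a multiplier `μ` with `Δ^η_{U₀}(D^{η*}_{U₀}A′) = Q′(U₀)ᵀμ` on `ℤ^{d+1}` (`m` levels; on `T_η` only the top level `𝔅_n = T^{(n)}` carries constraints,
`torusLam n`).  THIS FILE proves multiplier ⟹ projection at the constant-level torus member of the catalogue (`∀ z, j(z) = n`), transporters `parKnitY`
(p33's choice making def-Y's `Q′` the knit's `Q′`), `G′ := GpY parKnitY`: (§1) def-Y's site divergence of a member bond function IS `(c_fη)` × the knit's
`D^{η*}_{U♯}` of its lift (`divY_apply_eq_sum_cdsS` + J-A), and def-Y's `lapS` IS `η²` × the knit's `Δ^η` of the periodic lift at box points (J-A);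
(§2) at a box point, the knit's level-`n` transpose `Q′_n(U♯)ᵀν` of ANY multiplier `ν` IS `(L^{−(d+1)})ⁿ` × def-Y's `Q′*(U; parKnitY)` of the block reading
`s ↦ ν(label s)` (A1's `QprimeT_liftBL_at_box`; the transpose reads `ν` at the ancestor of the box point only — no periodicity of `μ` needed); (§3) hence,
under the knit's Landau condition, `Δ_U (D*_U a) ∈ range Q′*`, and def-Y's averaging term `Q′*aQ′` of `Δ′_a` ((3.24); `avgTerm_parKnitY_eq`) is in
`range Q′*` too, so `Δ′_a(U)(D*_U a) = Q′*v`; `G′ = (Δ′_a)⁻¹` (a unit — [4] Thm 3.1's regime, displayed) gives `D*_U a = G′Q′*v`, and (§3)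
`R(G′Q′*v) = G′Q′*v − G′Q′*(Q′G′²Q′*)⁻¹(Q′G′²Q′*)v = 0` whenever `Q′G′²Q′*` is a unit (Thm 3.2's regime, displayed) — print's «R is the projection onto
Δ N(Q′)» ((3.21)) read for the multiplier form: ★★ `RY_divY_eq_zero_of_isLandau138`.

WHAT THIS FILE PROVES (sorry-free; theorems only; no estimate asserted).
* §1 ★ `divY_siteAt` (`divY i U a (siteAt i x) = (c_fη) • covDivB η U♯ a♯ x` at every `x ∈ ℤ^{d+1}`), `liftL_divY`, ★ `lapS_eq_covLap_liftL` (box points).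
* §2 ★ `QprimeT_at_box_eq_QpsY` (any multiplier, constant-level member).
* §3 `RY_apply_Gp_QpsY` (`R(G′Q′*v) = 0` under `IsUnit (Q′G′²Q′*)`), `deltaPrimeAY_divY_mem_range` and ★★ **`RY_divY_eq_zero_of_isLandau138`**:
  `IsUnit (Δ′_a)`, `IsUnit (Q′G′²Q′*)` (at `parKnitY`, `GpY parKnitY`), `η ≠ 0`, knit Landau `IsLandau138 L n η ℤ^{d+1} (torusLam n) U♯ a♯` ⟹
  `RY i (parKnitY i) (GpY i (parKnitY i)) U (divY i U a) = 0`; ★★ `RY_divY_descBd_eq_zero` — the same at the sub-row's data (`U := bgY i U₀`,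
  `a := descBd i A′`, periodic `U₀`, `A′`, hypothesis `IsLandau138 … U₀ A′`).

HONEST SCOPE.  Exact finite algebra + the two carriers' dictionaries; NO estimate of [B8]∕[4] proved or assumed; the two invertibility hypotheses ([4] Thm 3.1∕
3.2's regime for `Δ′_a(U)` and `Q′G′²Q′*(U)` at `parKnitY`) are DISPLAYED (owners: G-B9-LETTERS M5.3 ∕ p33's `B9B8KnitLetterCoercive` road at the member);
the passage `W = e^{iηA′} ↦ A′ = (iη)⁻¹log W` (`IsLandau138W` ↦ `IsLandau138`) is the datum's own small-field reading, not made here; count-neutral;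
`B9P3PerAt` ∕ N05 ∕ `stub_PV3A` NOT discharged; nothing continuum ∕ ℝ⁴ ∕ OS ∕ mass-gap ∕ Clay — the Yang–Mills mass gap is NOT proved.  No `sorry`, no `axiom`,
no `… : Prop` fact, no `instance`, no `notation`.  NEW file; nothing landed is modified.  Seat `lit-balaban-t2s-1` gen 6, 2026-08-28.
-/

noncomputable section

open scoped BigOperators

namespace Literature.MathematicalPhysics.QuantumFieldTheory.Balaban1983to89.B9B8KnitLandauTransfer

open B7Prop1Explicit renaming Site → LSite
open B7Prop1Explicit (e)
open B7Eq78Linearization (conjR QprimeIter zdBlocking)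
open B8Eq119TwistedAxial (bgT)
open B8Ineq132 (covDerivFwd covDeriv)
open B8Eq138LandauZd (covLap covDivB QprimeT QT IsLandau138)
open B8Thm4TorusAt (torusLam)
open B12Ineq417Flat (shiftCfg)
open B10Eq27TorusAxialLog (transl transl_rel rel)
open B9Eq39Adjoint (R covD covDstar)
open B9BackgroundsKLevelV1 (CfgV1 shiftsV1)
open B6GlobalChartV1 (PV boxEquiv)
open B6KLevelCensusIndexV1 (KIdx)
open B6Geom246MultiLevelBox (bset blkOf blkOf_eq_iff_blk)
open B4Reflection242 (blk)
open Literature.MathematicalPhysics.QuantumLattice (blockMap)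
open B9B8CarrierDictionary (liftFun liftFun_apply liftCfg liftCfg_apply covDeriv_liftY covLap_liftY)
open B9B8KnitLetterTransfer (siteAt siteAt_eq siteAt_of_mem liftL liftL_eq liftL_apply blk_level blkAt blkAt_blk liftBL liftBL_self
  QprimeT_liftBL_at_box)
open B9B8AveragingJunction (parKnitY blockMap_iterate blk_eq_blockMap)
open B9B8DeltaPrimeJunction (QprimeT_eq_compT QT_torusLam_eq deltaPrimeAY_sub_lapS avgTerm_parKnitY_eq)
open B9B8KnitBondTransfer (liftBd liftBd_apply descBd liftBd_descBd)
open B8Thm2TorusLettersPerOfKnit (bgY liftCfg_bgY)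
open Node00.OpsYNablaBridge (chartY chartY_eq bondCompY bondCompY_apply divY_apply_eq_sum_cdsS)
open B6Ineq268MultiLevelBox (W W_eq)
open Node00

variable {d ℓ : ℕ} {hd : 1 ≤ d + 1} {hL : Odd (ℓ + 1) ∧ 1 < ℓ + 1} {b₀ b₁ : ℝ}
variable {𝔸 : Type} [NormedRing 𝔸] [NormedAlgebra ℂ 𝔸] [CompleteSpace 𝔸]
variable (i : KIdx d ℓ hd hL b₀ b₁)

/-! ## §1 The divergence `D*_U` and the site Laplacian on the two carriers -/

section Div

variable (η : ℝ) (U : CfgY 𝔸 i)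

omit [CompleteSpace 𝔸] in
/-- the lift of a bond component through `bondCompY` and the box chart is the component of the bond lift. [cite: Balaban1985BackgroundPropagators, p.391, bookkeeping] -/
theorem liftFun_bondCompY (a : FBondY i → 𝔸) (μ : Fin (d + 1)) :
    liftFun (P := PV d ℓ i.m i.K hd hL) (bondCompY i μ a ∘ ⇑(boxEquiv i.hN)) = fun w => liftBd i a w μ := by
  funext w
  rw [liftFun_apply, Function.comp_apply, liftBd_apply, bondCompY_apply]
  show a ⟨(boxEquiv i.hN).symm (boxEquiv i.hN (transl 0 w)), μ⟩ = a ⟨transl 0 w, μ⟩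
  rw [Equiv.symm_apply_apply]

/-- ★ **def-Y's SITE DIVERGENCE `(D*_U a)(z)` OF A MEMBER BOND FUNCTION IS `c_fη` × THE KNIT's `D^{η*}_{U♯} a♯`** at every `x ∈ ℤ^{d+1}` (read at the box
point `siteAt x` over `x`). [cite: Balaban1985BackgroundPropagators, (3.8) p.392; Balaban1985RegularSpaces, (1.1)–(1.2) p.76, (1.38) p.82] -/
theorem divY_siteAt (hη : η ≠ 0) (a : FBondY i → 𝔸) (x : LSite (d + 1)) :
    divY i U a (siteAt i x) = (((i.cf * η : ℝ)) : ℂ) • covDivB η (liftCfg U) (liftBd i a) x := by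
  rw [divY_apply_eq_sum_cdsS]
  unfold covDivB
  rw [Finset.smul_sum, Finset.smul_sum]
  refine Finset.sum_congr rfl fun μ _ => ?_
  have h := covDeriv_liftY i η U μ (bondCompY i μ a) x
  rw [liftFun_bondCompY] at h
  rw [siteAt_eq, h, ← Complex.coe_smul, smul_smul, Complex.ofReal_mul, mul_assoc, ← Complex.ofReal_mul, mul_inv_cancel₀ hη,
    Complex.ofReal_one, mul_one]

/-- the periodic lift of def-Y's site divergence of `a` IS `(c_fη)` × the knit's `D^{η*}_{U♯}a♯`. [cite: Balaban1985BackgroundPropagators, (3.8) p.392, bookkeeping] -/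
theorem liftL_divY (hη : η ≠ 0) (a : FBondY i → 𝔸) :
    liftL i (divY i U a) = fun x => (((i.cf * η : ℝ)) : ℂ) • covDivB η (liftCfg U) (liftBd i a) x := by
  funext x
  rw [liftL_apply, divY_siteAt i η U hη a x]

omit [CompleteSpace 𝔸] in
/-- the knit's covariant Laplacian is `ℂ`-homogeneous (the letters `covDerivFwd_smul`, `covDeriv_smul` by name; `B8Prop5JoinSectE.covLap_smul` is the C⋆ spelling). [cite: Balaban1985BackgroundPropagators, (3.23) p.394, bookkeeping] -/
theorem covLap_fun_smul (V : LSite (d + 1) → Fin (d + 1) → 𝔸ˣ) (c : ℂ) (g : LSite (d + 1) → 𝔸) (x : LSite (d + 1)) :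
    covLap η V (fun y => c • g y) x = c • covLap η V g x := by
  unfold covLap covDivB
  rw [Finset.smul_sum]
  refine Finset.sum_congr rfl fun μ _ => ?_
  have h1 : (fun z => covDerivFwd η V μ (fun y => c • g y) z) = c • fun z => covDerivFwd η V μ g z := by
    funext z
    exact B8Eq151V2Divergence.covDerivFwd_smul η V μ c g z
  rw [h1, B8Eq146AExpansion.covDeriv_smul]

/-- ★ **def-Y's SITE LAPLACIAN AT A BOX POINT IS `η²` × THE KNIT's `Δ^η_{U♯}` OF THE PERIODIC LIFT** (J-A's `covLap_liftY` read backwards).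
[cite: Balaban1985BackgroundPropagators, (3.23) p.394; Balaban1985RegularSpaces, (1.38) p.82] -/
theorem lapS_eq_covLap_liftL (hη : η ≠ 0) (Φ : SiteY i → 𝔸) (z : SiteY i) :
    lapS i U Φ z = (((η * η : ℝ)) : ℂ) • covLap η (liftCfg U) (liftL i Φ) z.1 := by
  have h := covLap_liftY i η U Φ z.1
  have hz : boxEquiv i.hN (transl 0 z.1) = z := siteAt_of_mem i z
  rw [hz] at h
  rw [liftL_eq, h, ← Complex.coe_smul, smul_smul, ← Complex.ofReal_mul,
    show η * η * (η⁻¹ * η⁻¹) = 1 by field_simp, Complex.ofReal_one, one_smul]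

end Div

/-! ## §2 The knit's transpose averaging of any multiplier, at a box point, is def-Y's `Q′*` of its block reading -/

section Transpose

variable {n : ℕ}

/-- ★ **`(Q′_n(U♯)ᵀ ν)(z) = (L^{−(d+1)})ⁿ · (Q′*(U; parKnitY) ψ_ν)(z)` AT EVERY BOX POINT, FOR EVERY MULTIPLIER `ν`** (constant level `n`): the transpose reads
`ν` only at the ancestor `y = ⌊z∕Lⁿ⌋` of the box point, which is the label of the block of `z`, so `ν` may be replaced by the periodic extension of its
block reading `ψ_ν(s) = ν(label s)` and A1's `QprimeT_liftBL_at_box` applies. [cite: Balaban1985BackgroundPropagators, (3.19) p.393, (3.24)–(3.25) pp.394–395; Balaban1985RegularSpaces, (1.29) p.81] -/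
theorem QprimeT_at_box_eq_QpsY (hlev : ∀ z : SiteY i, levY i z = n) (U : CfgY 𝔸 i) (ν : LSite (d + 1) → 𝔸) (z : SiteY i) :
    QprimeT (ℓ + 1) (liftCfg U) n ν z.1 = (((((ℓ + 1 : ℕ) : ℝ)) ^ (d + 1))⁻¹) ^ n • QpsY i (parKnitY i) U (fun s : BlkY i => ν s.1.2) z := by
  -- the ancestor of the box point is the label of its block
  have hanc : (blockMap (ℓ + 1))^[n] z.1 = blk ((ℓ + 1) ^ n) z.1 := by rw [blockMap_iterate, blk_eq_blockMap]
  have hl : (blkOf i.D.toDomains z).1.1 = n := blk_level i hlev _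
  have hlab : blk ((ℓ + 1) ^ n) z.1 = (blkOf i.D.toDomains z).1.2 := by
    have h := (blkOf_eq_iff_blk i.D.toDomains).1 (rfl : blkOf i.D.toDomains z = blkOf i.D.toDomains z)
    rwa [hl] at h
  have key : QprimeT (ℓ + 1) (liftCfg U) n ν z.1 = QprimeT (ℓ + 1) (liftCfg U) n (liftBL i n (fun s : BlkY i => ν s.1.2) n) z.1 := by
    rw [QprimeT_eq_compT, QprimeT_eq_compT, hanc, liftBL_self, blkAt_blk i hlev z, ← hlab]
  rw [key]
  exact QprimeT_liftBL_at_box i hlev U _ z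

end Transpose

/-! ## §3 Landau: multiplier form ⟹ projection form -/

section Landau

variable {n : ℕ}

/-- ★ **`R(U)(G′Q′*v) = 0`** — print's (3.25): `R = I − G′Q′*(Q′G′²Q′*)⁻¹Q′G′` kills the range of `G′Q′*` as soon as `Q′G′²Q′*` is a unit (so that its
`Ring.inverse` is a genuine left inverse); generic site letter `Gp` and transporters `parS`. [cite: Balaban1985BackgroundPropagators, (3.25) p.395, (3.21) p.394] -/
theorem RY_apply_Gp_QpsY (parS : SiteParY 𝔸 i) (Gp : SiteOpY 𝔸 i) (U : CfgY 𝔸 i) (hX : IsUnit (XY i parS Gp U)) (v : BlkY i → 𝔸) :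
    RY i parS Gp U (Gp U (QpsY i parS U v)) = 0 := by
  have hinv : XinvY i parS Gp U (QpY i parS U (Gp U (Gp U (QpsY i parS U v)))) = v := by
    have h := Ring.inverse_mul_cancel _ hX
    have hv := congrArg (fun T : (BlkY i → 𝔸) →ₗ[ℂ] (BlkY i → 𝔸) => T v) h
    simpa only [XinvY, XY, Module.End.mul_apply, LinearMap.comp_apply, Module.End.one_apply] using hv
  simp only [RY, LinearMap.sub_apply, LinearMap.id_apply, LinearMap.comp_apply, hinv, sub_self]

/-- ★★ **UNDER THE KNIT's LANDAU CONDITION, `Δ′_a(U)(D*_U a)` IS IN THE RANGE OF `Q′*(U; parKnitY)`** (constant-level member, `η ≠ 0`): the Laplacian part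
is `Q′ᵀμ` read on the box (§1–§2) and the averaging part is `Q′ᵀ(a·Q′·)` ((3.24), `avgTerm_parKnitY_eq`, §2).
[cite: Balaban1985RegularSpaces, (1.38) p.82, (1.57) p.86; Balaban1985BackgroundPropagators, (3.21) p.394, (3.24) p.394, (3.19) p.393] -/
theorem deltaPrimeAY_divY_mem_range (hlev : ∀ z : SiteY i, levY i z = n) {η : ℝ} (hη : η ≠ 0) (U : CfgY 𝔸 i) (a : FBondY i → 𝔸)
    (hLan : IsLandau138 (ℓ + 1) n η (Set.univ : Set (LSite (d + 1))) (torusLam (d := d + 1) n) (liftCfg U) (liftBd i a)) :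
    ∃ v : BlkY i → 𝔸, deltaPrimeAY i (parKnitY i) U (divY i U a) = QpsY i (parKnitY i) U v := by
  obtain ⟨μ, hμ⟩ := hLan
  -- the constants of the two carriers
  set c₁ : ℝ := i.cf * η with hc₁
  set cT : ℝ := ((((ℓ + 1 : ℕ) : ℝ)) ^ (d + 1))⁻¹ ^ n with hcT
  set κ : ℝ := B6MultiLevelBoxOperator.levC d ℓ (B6MultiLevelBoxOperator.aPrinted ℓ 1) n *
      ((((ℓ : ℝ) + 1) ^ n) ^ (d + 1) * (((ℓ : ℝ) + 1) ^ n) ^ (d + 1)) with hκ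
  -- the Laplacian part: `Δ_U (D*_U a) = η²·c₁·cT • Q′* ψ₁`, `ψ₁(s) = μ_n(label s)`
  set ψ₁ : BlkY i → 𝔸 := fun s => μ n s.1.2 with hψ₁
  have hlap : ∀ z : SiteY i, lapS i U (divY i U a) z = (((η * η * c₁ * cT : ℝ)) : ℂ) • QpsY i (parKnitY i) U ψ₁ z := by
    intro z
    have hL := hμ z.1 (Set.mem_univ _)
    rw [Set.indicator_univ] at hL
    rw [lapS_eq_covLap_liftL i η U hη, liftL_divY i η U hη, covLap_fun_smul, hL, QT_torusLam_eq,
      QprimeT_at_box_eq_QpsY i hlev U (μ n) z, ← Complex.coe_smul, smul_smul, smul_smul, ← Complex.ofReal_mul, ← Complex.ofReal_mul]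
  -- the averaging part: `Q′*aQ′ (D*_U a) = κ·cT • Q′* ψ₂`, `ψ₂(s) = (Q′_n f)(label s)`, `f` the periodic lift of `D*_U a`
  set ν₂ : LSite (d + 1) → 𝔸 := QprimeIter (zdBlocking (d + 1) (ℓ + 1)) (bgT (ℓ + 1) (liftCfg U)) n (liftL i (divY i U a)) with hν₂
  set ψ₂ : BlkY i → 𝔸 := fun s => ν₂ s.1.2 with hψ₂
  have havg : ∀ z : SiteY i, deltaPrimeAY i (parKnitY i) U (divY i U a) z - lapS i U (divY i U a) z =
      (((κ * cT : ℝ)) : ℂ) • QpsY i (parKnitY i) U ψ₂ z := by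
    intro z
    have hs : (blkOf i.D.toDomains z).1.1 = n := blk_level i hlev _
    rw [deltaPrimeAY_sub_lapS, avgTerm_parKnitY_eq, hlev z, W_eq, hs, ← liftL_eq, QprimeT_at_box_eq_QpsY i hlev U _ z, ← Complex.coe_smul,
      smul_smul, ← Complex.ofReal_mul, hκ]
  refine ⟨(((η * η * c₁ * cT : ℝ)) : ℂ) • ψ₁ + (((κ * cT : ℝ)) : ℂ) • ψ₂, ?_⟩
  funext z
  rw [map_add, map_smul, map_smul, Pi.add_apply, Pi.smul_apply, Pi.smul_apply, ← hlap z, ← havg z, add_sub_cancel]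

/-- ★★ **THE KNIT's LANDAU CONDITION (multiplier form) IMPLIES def-Y's `R(U)(D*_U a) = 0` (projection form)** at the constant-level torus member, transporters
`parKnitY`, letter `G′ = GpY parKnitY`, in the regime where `Δ′_a(U)` and `Q′G′²Q′*(U)` are units ([4] Thms 3.1∕3.2, displayed): `Δ′_a(D*_U a) = Q′*v`
(`deltaPrimeAY_divY_mem_range`) ⟹ `D*_U a = G′Q′*v` ⟹ `R(D*_U a) = 0` (`RY_apply_Gp_QpsY`).  This is the hypothesis `hLan` of r05's
`B8Eq158AtLettersY.eq158_atLettersY` ((1.57)₃ ⟹ the `D R D*` term drops out of `Δ_a(U)`).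
[cite: Balaban1985RegularSpaces, (1.38) p.82, (1.57)–(1.58) p.86; Balaban1985BackgroundPropagators, (3.21) p.394, (3.25)–(3.26) p.395] -/
theorem RY_divY_eq_zero_of_isLandau138 (hlev : ∀ z : SiteY i, levY i z = n) {η : ℝ} (hη : η ≠ 0) (U : CfgY 𝔸 i)
    (hΔ : IsUnit (deltaPrimeAY i (parKnitY i) U)) (hX : IsUnit (XY i (parKnitY i) (GpY i (parKnitY i)) U)) (a : FBondY i → 𝔸)
    (hLan : IsLandau138 (ℓ + 1) n η (Set.univ : Set (LSite (d + 1))) (torusLam (d := d + 1) n) (liftCfg U) (liftBd i a)) :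
    RY i (parKnitY i) (GpY i (parKnitY i)) U (divY i U a) = 0 := by
  obtain ⟨v, hv⟩ := deltaPrimeAY_divY_mem_range i hlev hη U a hLan
  have hf : divY i U a = GpY i (parKnitY i) U (QpsY i (parKnitY i) U v) := by
    have h1 := GpY_mul_deltaPrimeAY i (parKnitY i) U hΔ
    have h2 := congrArg (fun T : (SiteY i → 𝔸) →ₗ[ℂ] (SiteY i → 𝔸) => T (divY i U a)) h1
    simp only [Module.End.mul_apply, Module.End.one_apply] at h2
    rw [← h2, hv]
  rw [hf]
  exact RY_apply_Gp_QpsY i (parKnitY i) (GpY i (parKnitY i)) U hX v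

/-- ★★ **AT THE SUB-ROW's DATA**: for a `P₀`-periodic background `U₀` and a `P₀`-periodic knit bond field `A′` in the Landau gauge of record over `U₀`
(`IsLandau138 L n η ℤ^{d+1} (torusLam n) U₀ A′`, the multiplier form of `B9P3PerAt`'s hypothesis `IsLandau138W`), def-Y's projection form holds at the
member background: `R(bgY U₀)(D*(A′♭)) = 0`. [cite: Balaban1985RegularSpaces, (1.38) p.82, p.77 («Ω_j = T_η»); Balaban1985BackgroundPropagators, (3.21) p.394, (3.25) p.395] -/
theorem RY_divY_descBd_eq_zero (hlev : ∀ z : SiteY i, levY i z = n) {η : ℝ} (hη : η ≠ 0)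
    {U₀ : LSite (d + 1) → Fin (d + 1) → 𝔸ˣ}
    (hU₀ : ∀ μ : Fin (d + 1), shiftCfg ((((PV d ℓ i.m i.K hd hL).sitesPerDir 0 : ℕ) : ℤ) • e μ) U₀ = U₀)
    (hΔ : IsUnit (deltaPrimeAY i (parKnitY i) (bgY i U₀))) (hX : IsUnit (XY i (parKnitY i) (GpY i (parKnitY i)) (bgY i U₀)))
    {A' : LSite (d + 1) → Fin (d + 1) → 𝔸}
    (hA' : ∀ (x : LSite (d + 1)) (j : Fin (d + 1)), A' (x + (((PV d ℓ i.m i.K hd hL).sitesPerDir 0 : ℕ) : ℤ) • e j) = A' x)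
    (hLan : IsLandau138 (ℓ + 1) n η (Set.univ : Set (LSite (d + 1))) (torusLam (d := d + 1) n) U₀ A') :
    RY i (parKnitY i) (GpY i (parKnitY i)) (bgY i U₀) (divY i (bgY i U₀) (descBd i A')) = 0 := by
  refine RY_divY_eq_zero_of_isLandau138 i hlev hη (bgY i U₀) hΔ hX (descBd i A') ?_
  rw [liftCfg_bgY i hU₀, liftBd_descBd i hA']
  exact hLan

end Landau

end Literature.MathematicalPhysics.QuantumFieldTheory.Balaban1983to89.B9B8KnitLandauTransfer

end
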